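import Summits.QuantumFields.YangMills.Theorems.BalabanUVNodesN15KingModelFullPropagatorGradSourceHolderProfile
import Summits.QuantumFields.YangMills.Theorems.BalabanUVNodesN15KingModelFullPropagatorMixedHolderProfile
import Summits.QuantumFields.YangMills.Theorems.BalabanUVNodesN15KingModelFullPropagatorGradHolderPowerLaw
import Summits.QuantumFields.YangMills.Theorems.BalabanUVNodesN15KingModelFullPropagatorMixedPowerLaw

/-!
# BalabanUVNodes ∕ N15 — THE KING-MODEL RUNG, CURVED EDITION (PART Z): KING'S (3.65) EXPONENTS, LITERALLY — the power laws
# `(ρ∕N)^{−α}·|∂^{(2)}_νG(x′, y) − ∂^{(2)}_νG(x, y)| ≤ C·((L^K)∕m)^d·((L^K)∕m)^α` (`a = 0, |b| = 1`) and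
# `(ρ∕N)^{−α}·|DD_{μν}G(x′, y) − DD_{μν}G(x, y)| ≤ C·((L^K)∕m)^{d+1}·((L^K)∕m)^α` (`|a| = |b| = 1`), `m = dist({x, x′}, y) ≥ 1`, for King's full `A = 0`
# propagator, UNIFORMLY in `K`, the volume and the mass
# (Track A, DAG node N15 = NE2; FAN-OUT v1.1 §N15 s3 «KING-MODEL RUNG … + the one-line statement of what the curved case adds»)

HONEST FRAMING.  Count-neutral kernel bookkeeping (cell `pub-ymgap`, seat `pub-ymgap-dag-n15-e` g9; `--supports stmt-QuantumFields-20544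
--as helper` = K3⁷ `SpineGivenEndpointR13SepCoPH`, WORDS-143).  TEMPLATE LITERATURE, `A = 0`: C. King's scalar U(1)-Higgs MODEL on finite tori ([King1986]
(2.13)–(2.17) p. 653, (3.62) p. 663, Prop. 3.7 (3.65) p. 663 «`|(∂_α(x, y)D^a_xD^b_zG_{(j)})(z)| ≤ C(L^jη)^{2−d−|a|−|b|−α}exp[−δ₀(L^jη)^{−1}dist({x, y}, z)]`»;
King's `d` = this file's `d + 1`, so the summed exponents `2 − d_K − |a| − |b| − α` are `−(d + α)` for `(a, b) = (0, 1)` and `−(d + 1 + α)` for `(1, 1)`), NOT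
Bałaban's covariant objects.  The statements below are the (2.17)-SUMMED SHAPES of those two clauses (parts W-a `fullPropD2_holder_profile_unif`, Y-b
`fullPropDD_holder_profile_unif`) with the level sum evaluated by part U-c `levelSum_rpow_le_powerLaw`; decided in the MODEL; NOT printed propositions;
NE2⁺ is NOT PRINTED and not proved here; NOT a node discharge; nothing continuum ∕ ℝ⁴ ∕ OS ∕ mass-gap ∕ Clay.  0 `sorry`, 0 `def`, standard axioms.
* ★ `fullPropD2_holder_powerLaw_unif` (`d ≥ 1`), ★ `fullPropDD_holder_powerLaw_unif` — `0 < α < 1`, `y ≠ x, x′`, one `C` for all `K ≥ 1`, volumes, masses.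
With parts T-b (`(0,0)`: `((L^K)∕m)^{d−1}((L^K)∕m)^α`… via `fullProp_holder_dist_unif`) and U-c (`(1,0)`: `((L^K)∕m)^d((L^K)∕m)^α`) the `|a|, |b| ≤ 1` table of
(3.65) for the FULL `A = 0` propagator is complete in power-law form.
WHAT THE CURVED CASE ADDS (one line): the same four clauses for Bałaban's `G_k(U)` uniformly over `Reg335` ([B9] (3.43)–(3.45), printed, no η-rate).
HONEST SCOPE.  (i) `A = 0`, periodic b.c., odd `L ≥ 3`, `0 < m² ≤ m₀²`, cubes `2L^e`, `0 < α < 1`; (ii) lattice units of level `K`, sup torus distance,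
forward η-differences; (iii) `y ≠ x, x′` (`m ≥ 1`); (iv) not Bałaban's `G_k(U)`; not a discharge.
Locators: [King1986] (2.13)–(2.17) p. 653, (3.62), Prop. 3.7 (3.65) p. 663; [Balaban1985BackgroundPropagators] Thm 3.1 (3.43)–(3.45) p. 398.
-/

noncomputable section

namespace Summit.QuantumFields.YangMills.BalabanUVNodes.N15KingModelRung.Curved

open Real Finset Matrix
open Literature.MathematicalPhysics.QuantumFieldTheory.Balaban1983to89 (Params)
open Literature.MathematicalPhysics.QuantumFieldTheory.Balaban1983to89.B5Prop11Plancherel (Tor fine unitVec)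
open Literature.MathematicalPhysics.QuantumFieldTheory.King1986 (aK aK_pos)
open Literature.MathematicalPhysics.QuantumFieldTheory.King1986.Torus (constrainedProp blockOf tdistT tdistT_nonneg)

variable {d : ℕ} (L : ℕ) [NeZero L]

/-- **KING'S (3.65), `a = 0, |b| = 1`, SUMMED, AS A POWER LAW** (`d ≥ 1`, `0 < α < 1`): one `C` such that for all `K ≥ 1` (`N = L^K`), cubes `2L^e`,
`0 < m² ≤ m₀²`, `ν`, `x, x′` and `y ≠ x, x′`:  `(|x − x′|∕N)^{−α}·|∂^{(2)}_νG(x′, y) − ∂^{(2)}_νG(x, y)| ≤ C·((L^K)∕m)^d·((L^K)∕m)^α`, `m = min(|x − y|, |x′ − y|)`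
— part W-a's profile with the level sum evaluated (U-c `levelSum_rpow_le_powerLaw` at `p = d`).
[cite: King1986, (3.62) p.663, Prop. 3.7 (3.65) p.663; Balaban1985BackgroundPropagators, Thm 3.1 (3.43) p.398] -/
theorem fullPropD2_holder_powerLaw_unif (hd : 1 ≤ d) (hLodd : Odd L) (hL : 2 ≤ L) {a : ℝ} (ha : 0 < a) {m0sq : ℝ}
    (hm0 : 0 ≤ m0sq) {α : ℝ} (hα0 : 0 < α) (hα1 : α < 1) :
    ∃ C : ℝ, 0 < C ∧ ∀ (K : ℕ), 1 ≤ K → ∀ (N : ℕ) [NeZero N], N = L ^ K →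
      ∀ (e : ℕ) (M : Fin (d + 1) → ℕ) [∀ μ, NeZero (M μ)], (∀ μ, M μ = 2 * L ^ e) →
      ∀ (msq : ℝ), 0 < msq → msq ≤ m0sq → ∀ (ν : Fin (d + 1)) (x x' y : Tor (fine N M)), x ≠ y → x' ≠ y →
        (tdistT (fine N M) x x' / (N : ℝ)) ^ (-α) *
          |(N : ℝ) * (constrainedProp N M (aK a L K) (((N : ℕ) : ℝ) ^ 2) msq x' (y + unitVec (fine N M) ν)
              - constrainedProp N M (aK a L K) (((N : ℕ) : ℝ) ^ 2) msq x' y)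
            - (N : ℝ) * (constrainedProp N M (aK a L K) (((N : ℕ) : ℝ) ^ 2) msq x (y + unitVec (fine N M) ν)
              - constrainedProp N M (aK a L K) (((N : ℕ) : ℝ) ^ 2) msq x y)|
          ≤ C * (((L : ℝ) ^ K / min (tdistT (fine N M) x y) (tdistT (fine N M) x' y)) ^ d
                * ((L : ℝ) ^ K / min (tdistT (fine N M) x y) (tdistT (fine N M) x' y)) ^ α) := by
  obtain ⟨C, δ, hC, hδ, H⟩ := fullPropD2_holder_profile_unif (d := d) L hLodd hL ha hm0 hα0 hα1
  have hLr : (2 : ℝ) ≤ L := by exact_mod_cast hL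
  set Kp : ℝ := (2 * (d + 1).factorial / (δ / L) ^ (d + 1) + 2) / (L : ℝ) ^ d
      + (2 * (d + 1 + 1).factorial / (δ / L) ^ (d + 1 + 1) + 2) / (L : ℝ) ^ (d + 1) with hKp
  have hδL : 0 < δ / L := div_pos hδ (by positivity)
  have hKp0 : 0 < Kp := by positivity
  refine ⟨C * Kp, mul_pos hC hKp0, ?_⟩
  intro K hK N _ hN e M _ hM msq hmsq hcap ν x x' y hxy hx'y
  have h := H K hK N hN e M hM msq hmsq hcap ν x x' y
  set m : ℝ := min (tdistT (fine N M) x y) (tdistT (fine N M) x' y) with hmdef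
  have hm1 : 1 ≤ m := le_min (one_le_tdistT_of_ne (fine N M) hxy) (one_le_tdistT_of_ne (fine N M) hx'y)
  have hsum := levelSum_rpow_le_powerLaw hLr hδ hd hα0.le hα1.le K hm1
  have hN' : (N : ℝ) = (L : ℝ) ^ K := by rw [hN, Nat.cast_pow]
  have hsum' : ∑ i ∈ Finset.range K, ((L : ℝ) ^ d) ^ i * ((L : ℝ) ^ i) ^ α
        * Real.exp (-(δ * (m * (L : ℝ) ^ i / (N : ℝ))))
      ≤ Kp * (((L : ℝ) ^ K / m) ^ d * ((L : ℝ) ^ K / m) ^ α) := by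
    rw [hN']; exact hsum
  rw [LamL_eq_pow L hL] at h
  calc _ ≤ C * ∑ i ∈ Finset.range K, ((L : ℝ) ^ d) ^ i * ((L : ℝ) ^ i) ^ α
            * Real.exp (-(δ * (m * (L : ℝ) ^ i / (N : ℝ)))) := h
    _ ≤ C * (Kp * (((L : ℝ) ^ K / m) ^ d * ((L : ℝ) ^ K / m) ^ α)) := mul_le_mul_of_nonneg_left hsum' hC.le
    _ = C * Kp * (((L : ℝ) ^ K / m) ^ d * ((L : ℝ) ^ K / m) ^ α) := by ring

/-- **KING'S (3.65), `|a| = |b| = 1`, SUMMED, AS A POWER LAW** (`0 < α < 1`): one `C` such that for all `K ≥ 1` (`N = L^K`), cubes `2L^e`, `0 < m² ≤ m₀²`,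
`μ, ν`, `x, x′` and `y ≠ x, x′`:  `(|x − x′|∕N)^{−α}·|DD_{μν}G(x′, y) − DD_{μν}G(x, y)| ≤ C·((L^K)∕m)^{d+1}·((L^K)∕m)^α`, `m = min(|x − y|, |x′ − y|)` — part
Y-b's profile with the level sum evaluated (U-c `levelSum_rpow_le_powerLaw` at `p = d + 1`; `ΛL² = L^{d+1}` by V-a `LamL2_eq_pow`); the kernel of [B9]'s
(3.45) at `U ≡ 1` in Calderón–Zygmund form. [cite: King1986, (3.62) p.663, Prop. 3.7 (3.63)/(3.65) p.663; Balaban1985BackgroundPropagators, Thm 3.1 (3.45) p.398] -/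
theorem fullPropDD_holder_powerLaw_unif (hLodd : Odd L) (hL : 2 ≤ L) {a : ℝ} (ha : 0 < a) {m0sq : ℝ}
    (hm0 : 0 ≤ m0sq) {α : ℝ} (hα0 : 0 < α) (hα1 : α < 1) :
    ∃ C : ℝ, 0 < C ∧ ∀ (K : ℕ), 1 ≤ K → ∀ (N : ℕ) [NeZero N], N = L ^ K →
      ∀ (e : ℕ) (M : Fin (d + 1) → ℕ) [∀ μ, NeZero (M μ)], (∀ μ, M μ = 2 * L ^ e) →
      ∀ (msq : ℝ), 0 < msq → msq ≤ m0sq → ∀ (μ ν : Fin (d + 1)) (x x' y : Tor (fine N M)), x ≠ y → x' ≠ y →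
        (tdistT (fine N M) x x' / (N : ℝ)) ^ (-α) *
          |(N : ℝ) * ((N : ℝ) * (constrainedProp N M (aK a L K) (((N : ℕ) : ℝ) ^ 2) msq (x' + unitVec (fine N M) μ) (y + unitVec (fine N M) ν)
              - constrainedProp N M (aK a L K) (((N : ℕ) : ℝ) ^ 2) msq x' (y + unitVec (fine N M) ν))
            - (N : ℝ) * (constrainedProp N M (aK a L K) (((N : ℕ) : ℝ) ^ 2) msq (x' + unitVec (fine N M) μ) y
              - constrainedProp N M (aK a L K) (((N : ℕ) : ℝ) ^ 2) msq x' y))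
            - ((N : ℝ) * ((N : ℝ) * (constrainedProp N M (aK a L K) (((N : ℕ) : ℝ) ^ 2) msq (x + unitVec (fine N M) μ) (y + unitVec (fine N M) ν)
              - constrainedProp N M (aK a L K) (((N : ℕ) : ℝ) ^ 2) msq x (y + unitVec (fine N M) ν))
            - (N : ℝ) * (constrainedProp N M (aK a L K) (((N : ℕ) : ℝ) ^ 2) msq (x + unitVec (fine N M) μ) y
              - constrainedProp N M (aK a L K) (((N : ℕ) : ℝ) ^ 2) msq x y)))|
          ≤ C * (((L : ℝ) ^ K / min (tdistT (fine N M) x y) (tdistT (fine N M) x' y)) ^ (d + 1)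
                * ((L : ℝ) ^ K / min (tdistT (fine N M) x y) (tdistT (fine N M) x' y)) ^ α) := by
  obtain ⟨C, δ, hC, hδ, H⟩ := fullPropDD_holder_profile_unif (d := d) L hLodd hL ha hm0 hα0 hα1
  have hLr : (2 : ℝ) ≤ L := by exact_mod_cast hL
  set Kp : ℝ := (2 * (d + 1 + 1).factorial / (δ / L) ^ (d + 1 + 1) + 2) / (L : ℝ) ^ (d + 1)
      + (2 * (d + 1 + 1 + 1).factorial / (δ / L) ^ (d + 1 + 1 + 1) + 2) / (L : ℝ) ^ (d + 1 + 1) with hKp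
  have hδL : 0 < δ / L := div_pos hδ (by positivity)
  have hKp0 : 0 < Kp := by positivity
  refine ⟨C * Kp, mul_pos hC hKp0, ?_⟩
  intro K hK N _ hN e M _ hM msq hmsq hcap μ ν x x' y hxy hx'y
  have h := H K hK N hN e M hM msq hmsq hcap μ ν x x' y
  set m : ℝ := min (tdistT (fine N M) x y) (tdistT (fine N M) x' y) with hmdef
  have hm1 : 1 ≤ m := le_min (one_le_tdistT_of_ne (fine N M) hxy) (one_le_tdistT_of_ne (fine N M) hx'y)
  have hsum := levelSum_rpow_le_powerLaw hLr hδ (p := d + 1) (by omega) hα0.le hα1.le K hm1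
  have hN' : (N : ℝ) = (L : ℝ) ^ K := by rw [hN, Nat.cast_pow]
  have hsum' : ∑ i ∈ Finset.range K, ((L : ℝ) ^ (d + 1)) ^ i * ((L : ℝ) ^ i) ^ α
        * Real.exp (-(δ * (m * (L : ℝ) ^ i / (N : ℝ))))
      ≤ Kp * (((L : ℝ) ^ K / m) ^ (d + 1) * ((L : ℝ) ^ K / m) ^ α) := by
    rw [hN']; exact hsum
  rw [LamL2_eq_pow L hL] at h
  calc _ ≤ C * ∑ i ∈ Finset.range K, ((L : ℝ) ^ (d + 1)) ^ i * ((L : ℝ) ^ i) ^ α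
            * Real.exp (-(δ * (m * (L : ℝ) ^ i / (N : ℝ)))) := h
    _ ≤ C * (Kp * (((L : ℝ) ^ K / m) ^ (d + 1) * ((L : ℝ) ^ K / m) ^ α)) := mul_le_mul_of_nonneg_left hsum' hC.le
    _ = C * Kp * (((L : ℝ) ^ K / m) ^ (d + 1) * ((L : ℝ) ^ K / m) ^ α) := by ring

end Summit.QuantumFields.YangMills.BalabanUVNodes.N15KingModelRung.Curved
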